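import Summits.BirchSwinnertonDyer.Rank1Residual.X4.KuriharaLevelLoweringField
import HarnessLib

/-!
# What the level-lowering certificate forces on `f`'s OWN symbol: `ℓ`-orbit sums and twisted character sums vanish mod `p` (cell `b2b-bsdres`, seat additive-p4, line V43)

HONEST FRAMING (verbatim, cell `b2b-bsdres`): the goal of the cell is to DELETE the COMBINATION-SHAPED
residual classes for ALL analytic-rank `≤ 1` curves over `ℚ` — "full BSD formula for every rank `≤ 1`
curve in class `C`" assembled STRICTLY from published theorems — so that the rank-`≤ 1` remainder
becomes exactly the CONSTRUCTION-SHAPED classes, which are TYPED (missing-input Props), NOT attempted;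
this is not "finishing BSD". This file: a research-route KERNEL LEMMA file (pure algebra + three
corollaries for the tree's certificate predicate; no named fact, no conjecture, nothing booked; X4 stays
CONSTRUCTION-SHAPED).

## Why (line V43 of the seat; gen 20's V39 certificate read on `f` itself)

Gen 20–23 close the TAM-DEFECT₂ unit rows of X4 from ONE finite object, the mod-`p` `ℓ`-OLDFORM
IDENTITY `ι([r]⁺_f mod p) = μ(r) − μ(ℓ r)` for a `1`-periodic `μ` (the certificate
`PlusSymbolLevelLowersOver W p f ι ℓ` of `KuriharaLevelLoweringField`), whose provenance is Ribet's
level lowering (its cohomological content is `E[p] ⊆` the `ℓ`-old subvariety of `J₀(N)`, memo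
`V43-MAZUR-PRINCIPLE.md` of the seat). The certificate is an EXISTENTIAL statement about a level-`N/ℓ`
object `μ`. This file records what it forces on `f`'s OWN plus symbol — NECESSARY CONDITIONS that need
no level-`N/ℓ` computation and are therefore the cheap refutation test of the certificate for the
census lanes (E4 anomaly rule): an `ℓ`-old difference `φ = μ − w·μ∘[ℓ]`

* telescopes along `ℓ`-orbits: `∑_{i<t} wⁱ φ(ℓⁱ r) = μ(r) − wᵗ μ(ℓᵗ r)` (`orbitSum_oldform`), so it
  VANISHES on every closed orbit (`ℓᵗ r ≡ r (mod 1)`, `wᵗ = 1`; `orbitSum_oldform_eq_zero`);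
* has twisted character sums `∑_{a ∈ (ℤ/m)ˣ} χ(a) φ(a/m) = (1 − w χ(ℓ)⁻¹) ∑_a χ(a) μ(a/m)` for every
  `m` prime to `ℓ` and every multiplicative `χ : (ℤ/m)ˣ → R` (`charSum_oldform`, re-indexing
  `a ↦ ℓa`), so they VANISH whenever `w χ(ℓ)⁻¹ = 1` (`charSum_oldform_eq_zero`).

For the certificate (`w = 1`): every twisted sum `∑_{a ∈ (ℤ/m)ˣ} χ(a)·ι([a/m]⁺_f)` with `ℓ ∤ m` and
`χ(ℓ) = 1` vanishes in `k` (`sum_char_mul_ratPlusSymbol_eq_zero_of_plusSymbolLevelLowersOver`) — by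
Birch's formula (MTT 1986 §I.8) these are, for even primitive `χ` of conductor prime to `N`, Gauss-sum
multiples of `L(f, χ̄, 1)/Ω⁺_f`, so a `p`-UNIT twisted `L`-value at a character with `χ(ℓ) = 1`
REFUTES the certificate at `ℓ`; every closed `ℓ`-orbit sum of `[·]⁺_f` vanishes mod `p`
(`orbitSum_ratPlusSymbol_eq_zero_of_plusSymbolLevelLowersOver`); and (`r = 0`) `[0]⁺_f = L(f,1)/Ω⁺_f`
vanishes mod `p` (`ratPlusSymbol_zero_eq_zero_of_plusSymbolLevelLowersOver`) — the certificate at a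
split multiplicative `ℓ` can only hold on rows with `p ∣ L(E,1)/Ω⁺`, as it should (`p ∣ c_ℓ`).
The sign `w` is kept general in §1–§2: at a NON-split `ℓ` the old shape is `μ + μ∘[ℓ]` (`w = −1`),
which kills the twisted sums with `χ(ℓ) = −1` but NOT the Kurihara numbers (no Tamagawa defect there:
`c_ℓ ∈ {1, 2}`), consistent with Kim's Conjecture 1.10.

## References

* B. Mazur, J. Tate, J. Teitelbaum, Invent. Math. 84 (1986), §I.4 (4.2), §I.8. [cite: MazurTateTeitelbaum1986Invent, §I.4 (4.2) and §I.8]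
* C.-H. Kim, Amer. J. Math. 148 (2026) = arXiv:2203.12159, §1.2.2, §1.4.3. [cite: Kim2022StructureSelmer, §1.2.2 and §1.4.3]
* K. Ribet, W. Stein, *Lectures on Serre's conjectures*, IAS/Park City Math. Ser. 9 (2001), Thm. 3.14 (Mazur's principle). [cite: RibetStein2001, Thm. 3.14]
-/

noncomputable section

open scoped MatrixGroups ModularForm

open CongruenceSubgroup Finset

open Literature.NumberTheory.EllipticCurves Literature.NumberTheory.EllipticCurves.ModularForms

namespace Summit.BirchSwinnertonDyer.Rank1Residual.LevelLowering

/-! ### §1 `ℓ`-orbit sums of an `ℓ`-old difference telescope -/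

section OrbitSums

variable {R : Type*} [CommRing R] {μ φ : ℚ → R} {w : R} {ℓ : ℕ}

/-- **Telescoping along an `ℓ`-orbit.** If `φ(r) = μ(r) − w·μ(ℓ r)` for all `r`, then
`∑_{i<t} wⁱ φ(ℓⁱ r) = μ(r) − wᵗ μ(ℓᵗ r)`. [folklore] -/
theorem orbitSum_oldform (hφ : ∀ r : ℚ, φ r = μ r - w * μ (ℓ * r)) (r : ℚ) (t : ℕ) :
    ∑ i ∈ Finset.range t, w ^ i * φ ((ℓ : ℚ) ^ i * r) = μ r - w ^ t * μ ((ℓ : ℚ) ^ t * r) := by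
  induction t with
  | zero => simp
  | succ t ih =>
    rw [Finset.sum_range_succ, ih, hφ, pow_succ, pow_succ]
    have e : (ℓ : ℚ) * ((ℓ : ℚ) ^ t * r) = (ℓ : ℚ) ^ t * ℓ * r := by ring
    rw [e]
    ring

/-- **Closed `ℓ`-orbit sums of an `ℓ`-old difference vanish.** If `φ = μ − w·μ∘[ℓ]` with `μ`
`1`-periodic, `ℓᵗ r ≡ r (mod 1)` and `wᵗ = 1`, then `∑_{i<t} wⁱ φ(ℓⁱ r) = 0`. [folklore] -/
theorem orbitSum_oldform_eq_zero (hμ : IsPeriodic μ) (hφ : ∀ r : ℚ, φ r = μ r - w * μ (ℓ * r))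
    {r : ℚ} {t : ℕ} (hw : w ^ t = 1) (hr : ∃ z : ℤ, (ℓ : ℚ) ^ t * r = r + z) :
    ∑ i ∈ Finset.range t, w ^ i * φ ((ℓ : ℚ) ^ i * r) = 0 := by
  obtain ⟨z, hz⟩ := hr
  rw [orbitSum_oldform hφ, hw, one_mul, hμ.eq_of_eq_add_int z hz, sub_self]

end OrbitSums

/-! ### §2 Twisted character sums of an `ℓ`-old difference -/

section CharSums

variable {R : Type*} [CommRing R] {m : ℕ} [NeZero m] (χ : (ZMod m)ˣ →* R) {μ : ℚ → R}

/-- **Re-indexing a twisted sum by a unit**: `∑_a χ(a) μ((u a)/m) = χ(u⁻¹) · ∑_a χ(a) μ(a/m)` for a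
unit `u` of `ℤ/m` (substitute `a ↦ u⁻¹ a`). [folklore] -/
theorem sum_char_mul_lev_unit_mul (u : (ZMod m)ˣ) :
    ∑ a : (ZMod m)ˣ, χ a * lev μ m ((u * a : (ZMod m)ˣ) : ZMod m) =
      χ u⁻¹ * ∑ a : (ZMod m)ˣ, χ a * lev μ m (a : ZMod m) := by
  rw [Finset.mul_sum]
  refine Fintype.sum_equiv (Equiv.mulLeft u) _ _ fun a ↦ ?_
  simp only [Equiv.coe_mulLeft]
  rw [show χ a = χ u⁻¹ * χ (u * a) by rw [← map_mul, inv_mul_cancel_left], mul_assoc]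

/-- **Twisted character sums of an `ℓ`-old difference.** For `μ` `1`-periodic, `φ = μ − w·μ∘[ℓ]`,
`ℓ` prime to `m` and any multiplicative `χ : (ℤ/m)ˣ → R`:
`∑_{a ∈ (ℤ/m)ˣ} χ(a) φ(a/m) = (1 − w·χ(ℓ)⁻¹) · ∑_{a ∈ (ℤ/m)ˣ} χ(a) μ(a/m)`.
[cite: MazurTateTeitelbaum1986Invent, §I.8] -/
theorem charSum_oldform (hμ : IsPeriodic μ) {φ : ℚ → R} {w : R} {ℓ : ℕ} (hℓ : ℓ.Coprime m)
    (hφ : ∀ r : ℚ, φ r = μ r - w * μ (ℓ * r)) :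
    ∑ a : (ZMod m)ˣ, χ a * lev φ m (a : ZMod m) =
      (1 - w * χ (ZMod.unitOfCoprime ℓ hℓ)⁻¹) * ∑ a : (ZMod m)ˣ, χ a * lev μ m (a : ZMod m) := by
  set u : (ZMod m)ˣ := ZMod.unitOfCoprime ℓ hℓ with hu
  -- `φ(a/m) = μ(a/m) − w μ(ℓ a/m)` and `μ(ℓ a/m) = lev μ m (u a)`
  have hterm : ∀ a : (ZMod m)ˣ, lev φ m (a : ZMod m) =
      lev μ m (a : ZMod m) - w * lev μ m ((u * a : (ZMod m)ˣ) : ZMod m) := by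
    intro a
    rw [Units.val_mul, hu, ZMod.coe_unitOfCoprime, lev_natCast_mul hμ]
    unfold lev
    rw [hφ, mul_div_assoc]
  simp_rw [hterm, mul_sub, Finset.sum_sub_distrib]
  rw [show ∑ a : (ZMod m)ˣ, χ a * (w * lev μ m ((u * a : (ZMod m)ˣ) : ZMod m)) =
      w * ∑ a : (ZMod m)ˣ, χ a * lev μ m ((u * a : (ZMod m)ˣ) : ZMod m) by
    rw [Finset.mul_sum]; exact Finset.sum_congr rfl fun a _ ↦ by ring,
    sum_char_mul_lev_unit_mul χ u]
  ring

/-- **… and they VANISH when `w·χ(ℓ)⁻¹ = 1`** (for `w = ±1`: when `χ(ℓ) = w`).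
[cite: MazurTateTeitelbaum1986Invent, §I.8] -/
theorem charSum_oldform_eq_zero (hμ : IsPeriodic μ) {φ : ℚ → R} {w : R} {ℓ : ℕ} (hℓ : ℓ.Coprime m)
    (hφ : ∀ r : ℚ, φ r = μ r - w * μ (ℓ * r)) (hw : w * χ (ZMod.unitOfCoprime ℓ hℓ)⁻¹ = 1) :
    ∑ a : (ZMod m)ˣ, χ a * lev φ m (a : ZMod m) = 0 := by
  rw [charSum_oldform χ hμ hℓ hφ, hw, sub_self, zero_mul]

end CharSums

/-! ### §3 Necessary conditions of the certificate `PlusSymbolLevelLowersOver` on `f`'s own symbol -/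

section Certificate

variable {k : Type*} [CommRing k] {W : WeierstrassCurve ℚ} [W.IsGloballyMinimal] {p : ℕ} [Fact p.Prime]
  {N : ℕ} {f : CuspForm (Gamma0 N) 2} {ι : ZMod p →+* k} {ℓ : ℕ}

/-- **Twisted sums of `f`'s mod-`p` plus symbol vanish under the certificate**: if the mod-`p` plus
symbol of `f` level-lowers at `ℓ` over `k` (`PlusSymbolLevelLowersOver W p f ι ℓ`), then for every
`m ≥ 1` prime to `ℓ` and every multiplicative `χ : (ℤ/m)ˣ → k` with `χ(ℓ) = 1`,
`∑_{a ∈ (ℤ/m)ˣ} χ(a) · ι([a/m]⁺_f mod p) = 0`. By Birch's formula (MTT §I.8) these sums are, for even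
primitive `χ` of conductor prime to `N`, Gauss-sum multiples of `L(f, χ̄, 1)/Ω⁺_f`: a `p`-unit
twisted `L`-value at a character trivial on `ℓ` refutes the certificate at `ℓ` — a test that needs
no level-`N/ℓ` object. [cite: MazurTateTeitelbaum1986Invent, §I.8] [cite: Kim2022StructureSelmer, §1.4.3] -/
theorem sum_char_mul_ratPlusSymbol_eq_zero_of_plusSymbolLevelLowersOver
    (h : PlusSymbolLevelLowersOver W p f ι ℓ) {m : ℕ} [NeZero m] (hℓ : ℓ.Coprime m)
    (χ : (ZMod m)ˣ →* k) (hχ : χ (ZMod.unitOfCoprime ℓ hℓ) = 1) :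
    ∑ a : (ZMod m)ˣ, χ a * ι ((ratPlusSymbol f (((a : ZMod m).val : ℚ) / m) : ℚ) : ZMod p) = 0 := by
  obtain ⟨μ, hμ, -, hsym⟩ := h
  have hφ : ∀ r : ℚ, (fun s ↦ ι ((ratPlusSymbol f s : ℚ) : ZMod p)) r = μ r - 1 * μ (ℓ * r) := by
    intro r; simp only [one_mul]; exact hsym r
  have hw : (1 : k) * χ (ZMod.unitOfCoprime ℓ hℓ)⁻¹ = 1 := by
    have h1 : χ (ZMod.unitOfCoprime ℓ hℓ)⁻¹ * χ (ZMod.unitOfCoprime ℓ hℓ) = 1 := by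
      rw [← map_mul, inv_mul_cancel, map_one]
    rw [hχ, mul_one] at h1
    rw [one_mul, h1]
  have := charSum_oldform_eq_zero χ hμ hℓ hφ hw
  simpa only [lev] using this

/-- **Closed `ℓ`-orbit sums of `f`'s mod-`p` plus symbol vanish under the certificate**: if
`PlusSymbolLevelLowersOver W p f ι ℓ` and `ℓᵗ r ≡ r (mod 1)`, then `∑_{i<t} ι([ℓⁱ r]⁺_f mod p) = 0`.
[cite: Kim2022StructureSelmer, §1.4.3] [cite: MazurTateTeitelbaum1986Invent, §I.4 (4.2)] -/
theorem orbitSum_ratPlusSymbol_eq_zero_of_plusSymbolLevelLowersOver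
    (h : PlusSymbolLevelLowersOver W p f ι ℓ) {r : ℚ} {t : ℕ} (hr : ∃ z : ℤ, (ℓ : ℚ) ^ t * r = r + z) :
    ∑ i ∈ Finset.range t, ι ((ratPlusSymbol f ((ℓ : ℚ) ^ i * r) : ℚ) : ZMod p) = 0 := by
  obtain ⟨μ, hμ, -, hsym⟩ := h
  have hφ : ∀ s : ℚ, (fun s ↦ ι ((ratPlusSymbol f s : ℚ) : ZMod p)) s = μ s - 1 * μ (ℓ * s) := by
    intro s; simp only [one_mul]; exact hsym s
  have := orbitSum_oldform_eq_zero (w := (1 : k)) hμ hφ (one_pow t) hr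
  simpa only [one_pow, one_mul] using this

/-- **The certificate at `ℓ` forces `p ∣ [0]⁺_f = L(f,1)/Ω⁺_f`** (the orbit `{0}`): if
`PlusSymbolLevelLowersOver W p f ι ℓ` over a non-trivial `k`, then `[0]⁺_f ≡ 0 (mod p)` — the
`ℓ`-old identity at `r = 0` reads `ι([0]⁺) = μ(0) − μ(0)`. (On the TAM-DEFECT rows this is the
expected `p ∣ c_ℓ ∣ L(E,1)/Ω⁺`; a unit `[0]⁺` refutes the certificate.)
[cite: Kim2022StructureSelmer, §1.4.3] -/
theorem ratPlusSymbol_zero_eq_zero_of_plusSymbolLevelLowersOver [Nontrivial k]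
    (h : PlusSymbolLevelLowersOver W p f ι ℓ) : ((ratPlusSymbol f 0 : ℚ) : ZMod p) = 0 := by
  obtain ⟨μ, -, -, hsym⟩ := h
  have h0 : ι ((ratPlusSymbol f 0 : ℚ) : ZMod p) = 0 := by rw [hsym 0, mul_zero, sub_self]
  exact (map_eq_zero_iff ι ι.injective).mp h0

end Certificate

end Summit.BirchSwinnertonDyer.Rank1Residual.LevelLowering

end
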